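import Summits.ResolutionOfSingularities.ResolutionOfSingularities.Theorems.PinchCutKernels
import Summits.ResolutionOfSingularities.ResolutionOfSingularities.Theorems.WeakOrderReduction
import Summits.ResolutionOfSingularities.ResolutionOfSingularities.Theorems.GenericPointCutClasses
import Summits.ResolutionOfSingularities.ResolutionOfSingularities.Theorems.FaceFormCutClasses
import Summits.ResolutionOfSingularities.ResolutionOfSingularities.Theorems.VeryNearCutClasses
import Summits.ResolutionOfSingularities.ResolutionOfSingularities.Theorems.VeryNearCutKernels
import Summits.ResolutionOfSingularities.ResolutionOfSingularities.Theorems.DeltaFaceCutClasses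
import Summits.ResolutionOfSingularities.ResolutionOfSingularities.Theorems.DeltaFaceCutKernels
import Literature.AlgebraicGeometry.Resolution.HironakaTauScheme
import Literature.AlgebraicGeometry.Resolution.BlowupSequences
import Literature.AlgebraicGeometry.Resolution.MarkedIdeals
import Literature.AlgebraicGeometry.Resolution.StalkSpecializesLocalization
import Mathlib.FieldTheory.IsAlgClosed.AlgebraicClosure
import Mathlib.Algebra.CharP.Defs
import HarnessLib

/-!
# JetCutJetKernels — decomp-res node «JetCut» (lens-2 g15 rev 5), file 1/4 of `JetCutJetKernels`

[WRITER NOTE (decomp-res writer g9).  Content VERBATIM from the decomp-res lens-2 file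
`HOME/decomp-res-lens-2/g15/JetCut.lean` rev 5 (pin 9f53e5ca = `parts/JetCut-rev5-9f53e5ca.lean`, 7 495 l;
HOME = run/shared/lean/pub/decomp-res; CRITIC-LEDGER rows 109 / 115 / 120 / 121 / 122 / 127 / 133 CLEARED; landing
order INBOX :231; the critic's
HYGIENE-landing.md h1–h11 applied — DOCSTRING-ONLY).  The lens's blocks RESTATED VERBATIM from lens-2 g12 / g13 /
g14 (§R / §R13 / §R14) are DELETED:
they are the tree's `RelativeDeltaCut*` / `CurveLeafExit*` / `PinchCut*` modules (namespaces `RelativeDeltaCut`,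
`CurveLeafExit`, `PinchCut`, opened;
the lens's `CurveLeafExitRestated.x` / `PinchCutRestated.x` are cited as `CurveLeafExit.x` / `PinchCut.x`, the three
pointwise engine edges of g12 as
`RelativeDeltaCut.x`).  Namespace `…Theorems.JetCut` (the lens's `Theses.JetCut` is gate-reserved), sub-namespaces
`Tame` / `Wide` / `Broad` / `Vast`
as in the lens; file split only (tree files ≤ 400 lines): sections, variables and every declaration exactly as in
the lens, the long rev-0/1 prose
lives in HOME/decomp-res-lens-2/g15/NODE-g15.md §ARCHIVE-A (not in the tree).  Node files, in import order:
`JetCutJetKernels`, `JetCutPoint`, `JetCutClasses`, `JetCutKernels`, `JetCutTame`, `JetCutTameClasses`,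
`JetCutTameKernels`, `JetCutLadder`, `JetCutWideClasses`, `JetCutWideKernels`, `JetCutMixed`, `JetCutBroadClasses`,
`JetCutBroadKernels`, `JetCutDegenerate`, `JetCutVastClasses`, `JetCutVastKernels`
(each possibly continued `…2`, `…3`), then the wiring `MaxContactCutJetCut*` (in the Theses cone).  All `--supports
stmt-ResolutionOfSingularities-29273`
(`MaxContactCut.RungOne`); nothing closes 29273 — decided cells carry their engines as hypotheses, and exactly ONE
located-residual aside is booked on
the route for this column (`Vast.VastSpecialRung`, home `JetCutVastClasses`).  The lens header is kept verbatim below.]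

# JetCut — the REGULAR-CENTRE cell of the pinch-special core cut by the ONE-STEP NEAR-POINT CRITERION of a regular
clean top curve (EXACT-ON-PAPER [HunekeSwanson2006 Cor. 5.5.5; CossartJannsenSaito2020 Ch. 2]): ENGINE (J) `JetExit`
(ANY `d`, any residue field, any ideal, prepared or not: one blow-up of the curve exits ⟺ the curve is uniformly
JET-SHALLOW); the inclusion (C) ⊆ (J) PROVED as a kernel; the LENGTH-TWO law (J2) TYPED (where `deeptail:2` lives)
(decomp-res lens-2 «structural dichotomy (special vs generic)», g15)

ROOT DECOMPOSITION CELL `decomp-res`, RESIDUAL MODE (D-0179), generation 15.  TARGET (tree items, BY NAME):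
`MaxContactCut.RungOne` (stmt-29273, `E 2 → E 1`, the dimension-four core of the order axis in SEQUENCE form) — refines
`MaxContactCut:stmt-ResolutionOfSingularities-29273` — with the map edges to `MaxContactCut.StepPICoreDimFour` (28544,
kernel `MaxContactCutTauLadder.closes`) and to `MaxContactCut.ClosedPointCoreAll` (30461, kernel
`MaxContactCutGenericPointCut.rungOne_iff_core_of_rounds`), refinement edges BY NAME to the tree's g10 asides
`MaxContactCut.VNGenericRung` 32106 / `VNSpecialRung` 32107, the g9 asides `FFGenericRung` 31576 / `FFSpecialRung`
31577, the tree's g11 rungs `DeltaFaceCutClasses.DeltaGenericRung / DeltaSpecialRung`, and to lens-2 g12 / g13 / g14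
(`RelativeDeltaCut` — filed meanwhile as the tree's `Theorems.RelativeDeltaCutClasses`; `CurveLeafExit` — cleared row
90, filing pending; `PinchCut` rev 1 — cleared rows 97/100, filing pending as `Theorems.PinchCutClasses`): ALL THREE are
RESTATED VERBATIM in §R14 below exactly as they stand in the cleared g14 file (byte-identical decl bodies; g14's kernels
in `namespace PinchCutRestated`, g13's in `namespace CurveLeafExitRestated`), and become `open …` on filing.

CRITIC DIRECTION HONOURED (CRITIC-LEDGER row 97 remark r4 — seeds for g15: «(ii) special cone directions (d ≥ 2): a
SECOND-ORDER transversal cone …, bed Z² + v(U₁+U₂)² + …; (iii) mixed curves: class-≥-2 closed points interleaved on C»;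
row 100 rider r5: «conepinch:3/4 ALSO file as FLAT-1-with-normal-cone-exit in g13's d = 2 letter; (C)'s exclusive reach
is d ≥ 3; re-type the control with a generic tail» — the control IS re-typed here with tails, and it SPLITS: with the
tail `U₁³` it EXITS in one blow-up (new bed row `conetail:2`, decided by (J), in NO earlier class by letter), with the
tail `U₁⁵` the near point persists (`deeptail:2`, residual = the genuine second-order cone, a LENGTH-2 package, NEXT)).
WHAT THIS NODE DOES: g14 located the open matter of the CURVE stratum in the cell `SeqPSpecCurveReg n` (a pinch-special
non-isolated core top point on a clean curve REGULAR at it) and listed what is left there: «cancellation / deep / power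
DIRECTIONS of slope-one cones (d = 2 umbrellas; every n = 2, d ≥ 2 cone: (C) is EMPTY for n = 2, d ≥ 2), mixed curves,
deep / power pinches, non-monomial δ-special faces».  The first two items have a COMMON decided sub-class that none of
g13 (B), g14 (M), g14 (C) can see, because all three read ONE LAYER of a PREPARED presentation (the face `λvᵏuᵐ`, resp.
the degree-`n` transversal form `Φ`): the curves over which ONE blow-up ALREADY exits although the cone has bad
directions — the TAIL layers `n+1, …, 2n−1` rescue the bad directions (`z² + v(u₁+u₂)² + u₁³`: at the bad direction
`θ = (1:1)` the `u₁`-chart transform is `z'² + v w² + u₁·(unit)`, ORDER ONE) — and the curves through UNPREPARED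
class-≥-2 closed points whose first blow-up exits anyway.  Instead of typing one more readable layer (the CONE-TAIL test
(CT) below, sound but again partial), this node types the criterion that is exact on paper once and for all:

## (J) The ONE-STEP NEAR-POINT TEST — paper chain (0)–(3) (rev 0/1 text, ≈ 10 KB)

MOVED VERBATIM (rev 5, size) to NODE-g15.md §ARCHIVE-A.1 (= pinned rev-4 file lines 56–139); graded critic row 109,
unchanged since rev 1.  Its typed objects are §J1–§J3 below (`JetShallow`, `IsJetShallowAt`, `JetExit`, kernels), whose
docstrings restate each step where it is used.

## REV 5 (2026-08-30, g15): the DEGENERATE-VERTEX LADDER (§N, after §M) — critic row 127 window («every UNIT-vertex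
leader is (L) or (L′)»; item (i) the purity jump)

Rows 121/127 exhausted the principal tails whose `W`-leader has a UNIT coefficient.  rev 5 types the first NON-UNIT
vertex, `f = zⁿ + βUⁿ + β^m·ε·W^k + h` — the leader's coefficient a POWER OF THE TRANSVERSAL PARAMETER `β` (`ε` unit,
`1 ≤ m`, `n ≤ k`, `n ∤ k`, `m + (k % n) ≤ n`, `h ∈ WtIdeal c n k (nk+1)` — rev 3's weights VERBATIM; `DegLadderShape`):
at unit-`β` points it IS (L) by letter (KERNEL both ways), at the core points of `C` it is in no earlier class.  LAW (D),
full chain in the §N docstring: the `W`-chart reproduces the shape with `k ↦ k − n` (`deg_chart_identity` +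
`ladder_weight_step` BY NAME), the performed stages are rev 3's (leader of order `m + kᵢ ≥ n + 2`), depth `⌊k/n⌋`
(`deg_depth` from `ladder_depth` BY NAME); at the stop stage `k′ = k % n` a core point exits by ORDER (`m + k′ < n`:
`deg_no_cancel`, `deg_stop_degree`) or, when `m + k′ = n`, by CLASS ≥ 2 THROUGH THE TRANSVERSAL VARIABLE `β̄` — the
initial form `X̄₀ⁿ + ε̄β̄^mW̄^{k′} + Q̄` involves `β̄` and vanishes at the `β̄`-point: rev 4's `not_purePower_of_fibre` BY
NAME with `i₂ = β̄` (beds over `𝔽₂`, `𝔽₃`).  THREE EXITS, ONE LADDER: (L) order · (L′) class via the fibre variable ·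
(D) order via the bare `β^m` or class via `β̄`.  ENGINE `DegLadderExit` EXACT-ON-PAPER (every regular `Y`, residue
field, characteristic); CLASS `IsDegLadderCurvePt`; VAST leaf `IsVastCurvePt := IsBroadCurvePt ∨ IsDegLadderCurvePt`,
`VastExit := BroadExit ∧ DegLadderExit`, `IsVastSpecialPt` (KERNEL `⊆ IsBroadSpecialPt`); `Vast.closes
(hG : VastGenericRung) (hS : VastSpecialRung) : RungOne` BY NAME, `Vast.rungOne_iff` EXACT,
`Vast.broadSpecialRung_iff_vastSpecialRung (hG)` EXACT (also Wide/Tame/Jet).  Bed OUT of rev 4's residual (census ask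
T-deg-ladder): `z² + v(u₁+u₂)² + v·u₁⁵` (char 2; depth 2, class exit, stop form `X̄₀² + v̄ū₁` INVOLVING `v̄` — no (L′)
stop form does), `z³ + vU³ + v²u₁⁴` / `+ vu₁⁵` (class), `z³ + vU³ + vu₁⁴` (order).  BRIDGE to item (i): a unit leader
`εW^k`, `p ∣ k`, `ε̄ ∈ κᵖ`, is ABSORBED (`(z + W²)³ = z³ + W⁶` over `𝔽₃`, KERNEL) and leaves a DEGENERATE vertex —
(D) when `n ∤ k`; for `n ∣ k` the same ladder ends at the core by ORDER `m < n` (bed `z³ + vU³ + (1+v²)u₁⁶ + u₁^10`: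
`τ` STAYS 1 by letter, absorbed `m = 2`), the uniform statement being the typed next target (D⁺).  P-probes (D) ⇏ (L),
(D) ⇏ (L′), (L′) ⇏ (D) FAIL as they must.  LEFT: cancelling edge forms / binary towers, non-principal `I_y`, (D⁺),
Sing/Tangle/Iso.  SIZE NOTE (rev 5): the farm caps one check request near 512 KiB and rev 4 + §N reached 543 KB, so the
module-docstring prose of rev 0 ((J) paper chain, claims/pieces/bed/novelty/barriers/repair census) and the REV 2–4
paragraphs MOVED VERBATIM to NODE-g15.md §ARCHIVE-A; every section docstring (§J…§M) and every line of code of rev 4 is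
byte-identical in place (rev 5 = rev 4 − archived module prose + insertions).

## REV 4 (mixed ladder (L′), §M) · REV 3 (one-parameter ladder (L), §L) · REV 2 (tame branch (T), §T)

The three module-docstring paragraphs MOVED VERBATIM (rev 5, size) to NODE-g15.md §ARCHIVE-A.2 (= pinned rev-4 file
lines 140–230); their content stands IN PLACE in the section docstrings §T / §L / §M (unchanged, graded rows 120 / 121
/ 127) — (T): class-≥-2 near points are exits, `JetTameExit`; (L): `zⁿ + βUⁿ + εW^k + h`, depth `⌊k/n⌋`, order exit,
`LadderExit`, `Wide.closes`; (L′): unit mixed leader `εU^aW^b`, two weights, class exit through `W̄`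
(`not_purePower_of_fibre`), `MixedLadderExit`, `Broad.closes`.

## What is claimed · Pieces, tags, edges · Bed · Why novel · Barriers · REPAIR CENSUS (rev 0/1 text, ≈ 15 KB)

MOVED VERBATIM (rev 5, size) to NODE-g15.md §ARCHIVE-A.3 (= pinned rev-4 file lines 231–369; unchanged since rows
109/115).  Digest: ONE PORT (`CurvePackagePort`, EXACT-ON-PAPER: CossartJannsenSaito2020 Ch. 2, CossartPiltant2008
Prop. 4.2), engines as hypotheses, the SAME located cell (g14 `SeqPSpecCurveReg`); pieces `JetGenericRung` (decided) /
`JetSpecialRung` (located residual), `rungOne_iff` EXACT, `closes` BY NAME; bed `z² + v(u₁+u₂)² + u₁³` ∈ (J) ∖ (C);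
novelty = the one-step near-point test as a typed decidable class with kernel inclusions (searches in NODE-g15.md
§WHY NOVEL); barriers B1–B4 of the catalogue not engaged (local commutative algebra over regular local rings, no
characteristic-zero input); repair census = NODE-g15.md §REPAIR CENSUS.

## This file

§J1 + §J1b: RING LEVEL of the jet test — the chart relations `chartRel` of the blow-up algebra of a regular
sequence, the ONE-STEP test `JetShallow`, and its KERNELS over an arbitrary commutative ring: representability of
`(c)^{m+1}` by forms, **`jetShallow_of_coneShallow`** ((C) ⊆ (J), PROVED), `not_jetShallow_zero` (quantifier-shape
sanity), the typed (CT) test `ConeTailShallow`, the regularity port `ExcParamRegular`,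
**`jetShallow_of_coneTailShallow`** ((CT) ⊆ (J) modulo the port, PROVED).

Part 1/4 carries: `chartRel`, `JetShallow`, `exists_form_of_mem_span_pow_succ`, `algHom_apply_mem_of_coeff_mem`.

(Sources: HunekeSwanson2006 Cor. 5.5.5; CossartJannsenSaito2020 Ch. 2, Thm. 3.6/3.7, Ch. 8; CossartPiltant2008 Prop.
4.2; CossartPiltant2019 Rem. 3.2; Hironaka1964 Ch. III; Hironaka1967; Hironaka1977; Moh1987; Giraud1975.)
-/

open CategoryTheory AlgebraicGeometry TopologicalSpace IsLocalRing
open Literature.AlgebraicGeometry.Resolution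
open Summit.ResolutionOfSingularities.ResolutionOfSingularities.Theorems
open Summit.ResolutionOfSingularities.ResolutionOfSingularities.Theorems.WeakOrderReduction
open Summit.ResolutionOfSingularities.ResolutionOfSingularities.Theorems.DeltaFaceCutClasses
open Summit.ResolutionOfSingularities.ResolutionOfSingularities.Theorems.RelativeDeltaCut
open Summit.ResolutionOfSingularities.ResolutionOfSingularities.Theorems.CurveLeafExit
open Summit.ResolutionOfSingularities.ResolutionOfSingularities.Theorems.PinchCut

namespace Summit.ResolutionOfSingularities.ResolutionOfSingularities.Theorems.JetCut

section Jet

variable {R : Type} [CommRing R] {d : ℕ}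

/-! ## §J1  NEW (g15): ring level — the chart relations of the blow-up algebra of a regular sequence and the ONE-STEP
NEAR-POINT TEST `JetShallow` (EXACT-ON-PAPER; every chart, every closed point of the exceptional fibre, scheme-theoretically) -/

/-- **Chart-`j` RELATIONS of the blow-up algebra** (`chartRel c j`): the ideal of `R[X]` generated by the linear
relations `c_i − c_j·X_i` (`i ≠ j`; the `j`-th generator is `c_j − c_j·1 = 0` through `dehomog`, so `X_j` stays a
phantom variable).  For `c` part of a regular system of parameters of a regular local ring (a regular sequence) the
quotient `R[X]/chartRel c j` IS the affine blow-up algebra `R[c/c_j]` (the Rees algebra of an ideal generated by a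
regular sequence is its symmetric algebra — Micali, Huneke: no `c_j`-saturation needed), and for a maximal `𝔐 ⊇ 𝔪_R·R[X]`
the local ring `(R[X]/chartRel c j)_𝔐` is `𝒪_{Y₁,x'}` at the CLOSED point `x'` of the chart-`j` exceptional fibre over
the closed point, with coordinates `X_i(x') = (c_i/c_j)(x')`, `i ≠ j`.  DEFINITION (NEW object, support). (Sources:
Huneke1980; Micali1964; CossartJannsenSaito2020 Ch. 8; StacksProject Tag 0804.) -/
noncomputable def chartRel {S : Type} [CommRing S] {d : ℕ} (c : Fin d → S) (j : Fin d) :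
    Ideal (MvPolynomial (Fin d) S) :=
  Ideal.span (Set.range fun i : Fin d =>
    MvPolynomial.C (c i) - MvPolynomial.C (c j) * dehomog j (MvPolynomial.X i))

/-- **JET-SHALLOW = the ONE-STEP NEAR-POINT TEST (EXACT-ON-PAPER)** (`JetShallow M c J n`, `M = 𝔪_R`, `c = (z, u₁, …, u_d)` the
curve parameters, `J = I_y`): for every chart `j` and every MAXIMAL ideal `𝔐` of `R[X₀, …, X_d]` containing `𝔪_R` and
the phantom variable `X_j` — i.e. every CLOSED point `x'` of the chart-`j` exceptional fibre `{c_j·𝒪 = 𝓘_E} ≅ 𝔸^d_{κ}`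
over the closed point (`X₀ = z/c_j` INCLUDED: no directrix convention, unprepared points allowed) — SOME element
`f = F(c) ∈ I_y`, `F ∈ R[X]` homogeneous of degree `n`, has chart-`j` transform `f/c_jⁿ = dehomog_j F (mod chartRel)` NOT
in `chartRel c j + 𝔐ⁿ`.  Since `chartRel + 𝔐ⁿ` is `𝔐`-primary (`𝔐ⁿ ⊆ chartRel + 𝔐ⁿ ⊆ 𝔐`), non-membership is LOCAL:
`⟺ ord_{x'}(f/c_jⁿ) < n`; and the controlled transform `I₁ = c_j^{−n}·I·𝒪_{Y₁}` is generated by the `f/c_jⁿ`, `f ∈ I_y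
⊆ (c)ⁿ`, each of which is `F(c)` for a degree-`n` form `F` with coefficients in `R`.  HENCE, for `I_y ⊆ (c)ⁿ` on a
regular `Y`:  `JetShallow 𝔪 c I_y n ⟺ after blowing up the curve V(c) NO point of Y₁ over y has order n` —
EXACT-ON-PAPER [HunekeSwanson2006 Cor. 5.5.5 (linear type); localisation], every residue field, every `d`, every ideal
(principal or not).  SIGNATURE NOTE (critic cn21 (3)): `R` is ANY commutative ring (at a point: `𝒪_{Y,y}`); ALL `d + 1`
variables `X₀, …, X_d` are kept in every chart; in chart `j` the phantom variable `X_j` stays in the ring and only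
`dehomog j` substitutes `X_j := 1` INSIDE the witness `F`; the clause `𝔐 ⊇ 𝔪R[X] + (X_j)` pins the phantom coordinate to
`0`, so the admissible `𝔐` are in bijection with the maximal ideals of `κ(y)[X_i : i ≠ j]`, i.e. the CLOSED points of the
chart-`j` fibre `𝔸^d_{κ(y)}` (the coordinate `X₀ = z/c_j` included); the phantom is harmless: for `G` free of `X_j`,
`G ∈ chartRel c j + 𝔐ⁿ ⟺ G ∈ (c_i − c_jX_i : i ≠ j) + 𝔐₀ⁿ` in `R[X_{i≠j}]` (substitute `X_j := 0`; `𝔐 = 𝔐₀R[X] + (X_j)`).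
Kernel sanity: `not_jetShallow_zero` (at `n = 0` the test fails for proper `M`), `jetShallow_of_coneShallow` (the whole
g14 (C) family passes), the `chartIdeal` examples of §J3c.  Readable SUB-TESTS (paper, module docstring):
g13's FLAT-1 (`d = 1`), g14's cone-shallow prepared cones (C), the CONE-TAIL test (CT) (`Φ ∈ v·R[U]` prepared and
normalised, first tail layer `G_{n+1}`: at each direction `θ`, cone-shallow OR `Ḡ_j(θ) ≠ 0`), and UNPREPARED points
(unit coefficients in the layer-`n` form: class ≥ 2 closed points of a mixed curve).  DEFINITION (NEW class predicate:
the one-step near-point criterion). (Sources: Hironaka1964 Ch. III; Hironaka1967; CossartJannsenSaito2020 Ch. 2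
(near points, Thm 2.14), Ch. 8; CossartPiltant2008 Prop. 4.2.) -/
def JetShallow (M : Ideal R) (c : Fin d → R) (J : Ideal R) (n : ℕ) : Prop :=
  ∀ (j : Fin d) (Q : Ideal (MvPolynomial (Fin d) R)), Q.IsMaximal →
    Ideal.map (MvPolynomial.C : R →+* MvPolynomial (Fin d) R) M ≤ Q →
    (MvPolynomial.X j : MvPolynomial (Fin d) R) ∈ Q →
      ∃ F : MvPolynomial (Fin d) R, F.IsHomogeneous n ∧ MvPolynomial.eval c F ∈ J ∧
        dehomog j F ∉ chartRel c j ⊔ Q ^ n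

end Jet

section JetKernels

variable {R : Type} [CommRing R] {d : ℕ}

/-! ## §J1b  NEW (g15): ring-level KERNELS of the jet test — `(C) ⊆ (J)` PROVED, `(CT) ⊆ (J)` PROVED modulo ONE
typed regularity port [rev 1], quantifier-shape sanity

Answer to critic cn21 (5) («give the implications as kernels: coneShallow → jetShallow») and cn21 (1) («(CT) PROVED
sound, kernel preferred»).  PROVED HERE, 0 sorry, pure commutative algebra over an ARBITRARY commutative ring `R` (no
regularity, no residue-field hypothesis — except the ONE typed port `ExcParamRegular` consumed by the (CT) kernel):

* `exists_form_of_mem_span_pow_succ` — an element of `(c)^{m+1}` is `G(c)` for a degree-`m` FORM `G` with coefficients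
  in `(c)` (the controlled-transform bookkeeping `g ↦ G`, `dehomog_j G ∈ 𝔪·𝒪'`);
* `algHom_apply_mem_of_coeff_mem` — an `R`-algebra map sends a polynomial with coefficients in `𝔟` into any ideal
  containing the image of `𝔟`;
* `jetShallow_of_coneShallow` — **(C) ⊆ (J) at ring level**: a slope-one prepared presentation
  `c₀ⁿ + Φ(c₁, …, c_d) + g ∈ J`, `Φ` a degree-`n` form with coefficients in `(c, v)`, `g ∈ (c)^{n+1}`, which is
  CONE-SHALLOW (g14: `Φ̄_j ∉ 𝔑ⁿ` at every maximal `𝔑 ∋ v̄, U_j` of `(R/𝔭)[U]`) is JET-SHALLOW (g15) at marking `n ≥ 1`.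
  Proof: witness `F := X₀ⁿ + Φ(X₁, …, X_d) + G`; at a closed point `𝔐` of chart `j` with `X₀ ∉ 𝔐` (or `j = 0`) the
  term `X₀ⁿ` (resp. `1`) is a unit modulo `𝔐` while `dehomog_j Φ̃, dehomog_j G ∈ 𝔐` (coefficients in `𝔪`); at a closed
  point with `X₀ ∈ 𝔐`, `j = i.succ`, transport along `ψ : R[X] → (R/𝔭)[U]`, `X₀ ↦ 0`, `X_{k+1} ↦ U_k`, coefficients
  mod `𝔭`: `ψ(chartRel) = 0`, `ψ(𝔐) ⊆ 𝔑 := ker χ` where `χ ∘ ψ = (mod 𝔐)` (so `𝔑` is maximal, `∋ v̄, U_i`),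
  `ψ(dehomog_j G) ∈ 𝔑ⁿ` (coefficients in `𝔭 ↦ 0`… in fact `= 0`), `ψ(dehomog_j X₀ⁿ) = 0`, and
  `ψ ∘ dehomog_j ∘ rename succ = dehomog_i ∘ (mod 𝔭)`; so `dehomog_j F ∈ chartRel + 𝔐ⁿ` would give `Φ̄_i ∈ 𝔑ⁿ`,
  contradicting cone-shallowness.  (The hypothesis `n ≠ 0` is NECESSARY: `not_jetShallow_zero`.)
* `not_jetShallow_zero` — quantifier-shape sanity (critic cn21 (3)): for `M` proper the test FAILS at `n = 0`
  (`𝔐 ⊇ 𝔪R[X] + (X_j)` is satisfiable — the phantom variable `X_j` lives in the ring, only `dehomog_j` kills it inside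
  the witness — and `𝔐⁰ = ⊤`).

* [rev 1] `ConeTailShallow` (the typed (CT) test: cone branch `dehomog_j(v̄Ψ̄) ∉ 𝔑ⁿ` OR tail branch `dehomog_j Γ̄ ∉ 𝔑`),
  `ExcParamRegular` (the typed regularity port: `u_j·T ∈ chartRel + 𝔐² + (X₀) + (v) ⇒ T ∈ 𝔐` at the fibre points with
  `X₀ ∈ 𝔐`; TRUE at regular points, EXACT-ON-PAPER; false for `c_j = 0`, probe P32), `exists_form_of_mem_mul_span_pow`
  (`g ∈ 𝔞·(c)^m` is `G(c)` for a degree-`m` form with coefficients in `𝔞`), and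
  `jetShallow_of_coneTailShallow` — **(CT) ⊆ (J) at ring level modulo the port**, `n ≥ 2`.

NOT provable at this level (honest, see the module docstring «PORT HYGIENE»): `flat1 → jetShallow` (g13's FLAT-1 letter
`zⁿ + λ·v·uⁿ + g`, `λ` a unit) needs `v̄ ∉ 𝔑ⁿ` in `(R/𝔭)[U]`, i.e. that `v` is a regular parameter of the DVR `R/𝔭` —
a REGULARITY input of a different shape (it IS g14's (C) hypothesis for `Φ = λvUⁿ`), not a transport identity; it is
recorded as the must-FAIL probe P24. -/

/-- Representability: an element of `(c)^(m+1)` is the value at `c` of a degree-`m` form with coefficients in `(c)`.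
[folklore] -/
theorem exists_form_of_mem_span_pow_succ {k : ℕ} (c : Fin k → R) (m : ℕ) {g : R}
    (hg : g ∈ Ideal.span (Set.range c) ^ (m + 1)) :
    ∃ G : MvPolynomial (Fin k) R, G.IsHomogeneous m ∧ (∀ β, G.coeff β ∈ Ideal.span (Set.range c)) ∧
      MvPolynomial.eval c G = g := by
  induction m generalizing g with
  | zero =>
    refine ⟨MvPolynomial.C g, MvPolynomial.isHomogeneous_C _ _, ?_, by simp⟩
    intro β
    rw [MvPolynomial.coeff_C]
    split_ifs with h
    · simpa using hg
    · exact Ideal.zero_mem _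
  | succ m ih =>
    rw [pow_succ] at hg
    refine Submodule.mul_induction_on hg ?_ ?_
    · intro a ha b hb
      obtain ⟨G, hGh, hGc, hGe⟩ := ih ha
      obtain ⟨r, hr⟩ := Ideal.mem_span_range_iff_exists_fun.1 hb
      refine ⟨G * ∑ i, MvPolynomial.C (r i) * MvPolynomial.X i, ?_, ?_, ?_⟩
      · refine hGh.mul ?_
        refine MvPolynomial.IsHomogeneous.sum _ _ _ ?_
        intro i _
        simpa using (MvPolynomial.isHomogeneous_C _ (r i)).mul (MvPolynomial.isHomogeneous_X R i)
      · intro β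
        rw [MvPolynomial.coeff_mul]
        refine Ideal.sum_mem _ ?_
        intro x _
        exact Ideal.mul_mem_right _ _ (hGc x.1)
      · simp [hGe, hr]
    · rintro x y ⟨Gx, hx1, hx2, hx3⟩ ⟨Gy, hy1, hy2, hy3⟩
      refine ⟨Gx + Gy, hx1.add hy1, fun β => ?_, by simp [hx3, hy3]⟩
      rw [MvPolynomial.coeff_add]
      exact Ideal.add_mem _ (hx2 β) (hy2 β)

/-- Coefficient lemma: an algebra map sends a polynomial with coefficients in `𝔟` into any ideal containing the
images of `𝔟`. [folklore] -/
theorem algHom_apply_mem_of_coeff_mem {σ : Type} {S : Type} [CommRing S] [Algebra R S]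
    (φ : MvPolynomial σ R →ₐ[R] S) (𝔟 : Ideal R) (Q : Ideal S)
    (hQ : ∀ b ∈ 𝔟, algebraMap R S b ∈ Q) (H : MvPolynomial σ R) (hH : ∀ β, H.coeff β ∈ 𝔟) :
    φ H ∈ Q := by
  rw [H.as_sum, map_sum]
  refine Ideal.sum_mem _ ?_
  intro β _
  have : MvPolynomial.monomial β (H.coeff β) = MvPolynomial.C (H.coeff β) * MvPolynomial.monomial β 1 := by
    rw [MvPolynomial.C_mul_monomial, mul_one]
  rw [this, map_mul, MvPolynomial.algHom_C]
  exact Ideal.mul_mem_right _ _ (hQ _ (hH β))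

end JetKernels

end Summit.ResolutionOfSingularities.ResolutionOfSingularities.Theorems.JetCut
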